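import Mathlib
import HarnessLib
import Summits.HubbardSuperconductivity.HubbardSuperconductivity.Theorems.KLProgrammeKLRegimeVolumeLimitV11HSupOfAtoms

/-!
# Route `KLProgramme` — crux K3, VL child `KLRegimeVolumeLimitV17F2` (stmt-HubbardSuperconductivity-20440), skeleton «cauchy» v11: THE `hSup` DISCHARGER,
# part 3 — `stub_vl_towerData` UNDER `R.WF2` FROM THE FIVE NAMED ATOMS AND THE PRODUCER TEXT (seat hubbard-kl-k3c4-p1 g16; `--supports` 20440)

**`stub_vl_towerData_WF2_of_atoms`** — the five atoms `Hcov / HE1 / Hmis / Hbase / Hgrid` of `…V11HSupOfAtoms` (their docstring there) + the producer text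
(`stub_vl_srcProfiles`, v10/v11 form) ⇒ the conclusion of the registered data stub `stub_vl_towerData` (v11) for every `(G, P, Q, R)` with `R.WF2`:
`∃ c₅ > 0, ∀ c ≤ c₅, ∃ U₀ > 0, ∀ μ ∈ klWindowC, ∀ U ≤ U₀, ∀ β (regime) K (frameOK) Lstar Mstar, TowerP … → ∃ t ∈ (0,1], Nonempty (TowerDataTS β U μ t)`.
The threading is `…V11TowerDataOfSuppliersReg.stub_vl_towerData_of_suppliers_reg_pos`'s (c₅/U₀ := min of the producer's, the `ε`-doors' and the atoms';
`A ↦ A⁺`) over `hSupRegBody_of_atoms`; the only difference from the registered stub text is the binder `R.WF2` (located «VL-R-WF2»: the suppliers' doors are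
stated under `R.WF2`; the K3 glue holds `R.WF2` from child 2).  So the VL data stub is CLOSED MODULO the five atoms and that binder.

Proofs only; no definition.  Honest framing: plumbing; nothing here asserts any atom, the producer text, the stub, K3, VL or superconductivity.
[cite: BenfattoGiulianiMastropietro2006, §2.7-§2.9 and §3]
-/

noncomputable section

namespace Summit.HubbardSuperconductivity.HubbardSuperconductivity.Theorems.TwoVolumeSource

set_option linter.dupNamespace false -- summit = problem name (single-conjunct summit), D-0017

open Finset Filter Topology Literature.MathematicalPhysics.QuantumLattice GrassmannAlgebra Literature.Probability.LatticeModels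
  Literature.Probability.LatticeModels.BattleFederbush
open Summit.HubbardSuperconductivity.HubbardSuperconductivity.Theorems.KLRegimeSplit
open Summit.HubbardSuperconductivity.HubbardSuperconductivity.Theorems.KLProgrammeLegKernels
open Summit.HubbardSuperconductivity.HubbardSuperconductivity.Theorems.TwoPointAssembly
open Summit.HubbardSuperconductivity.HubbardSuperconductivity.Theorems.EngineV8
open Summit.HubbardSuperconductivity.HubbardSuperconductivity.Theorems.TwoVolumeDefect
open Summit.HubbardSuperconductivity.HubbardSuperconductivity.Theorems.TorusFourierL2

/-! ## The VL data stub under `R.WF2` from the five atoms and the producer text -/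

/-- **`stub_vl_towerData` (v11) UNDER `R.WF2`, FROM THE FIVE ATOMS AND THE PRODUCER TEXT** (`stub_vl_srcProfiles`): the threading of
`…V11TowerDataOfSuppliersReg.stub_vl_towerData_of_suppliers_reg_pos` (c₅/U₀ := min of the producer's, the `ε`-doors' and the atoms'; `A ↦ A⁺`) over
`hSupRegBody_of_atoms`.  The only difference from the registered stub text is the binder `R.WF2` (located «VL-R-WF2»).
[folklore: quantifier threading; cite: BenfattoGiulianiMastropietro2006, §2.7-§2.9 and §3] -/
theorem stub_vl_towerData_WF2_of_atoms
    (Hcov : ∀ (G : GeoConsts) (P : SplitConsts) (Q : EngConsts) (R : RenConsts), G.WF → P.WF → Q.WF → R.WF2 →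
      ∃ k₁ a₁ s₁ e₁ w₁ ρ : ℝ, 0 < k₁ ∧ 0 < a₁ ∧ 0 ≤ s₁ ∧ 0 ≤ e₁ ∧ 1 ≤ w₁ ∧ 0 < ρ ∧
        ∃ c₇ : ℝ, 0 < c₇ ∧ ∀ c : ℝ, 0 < c → c ≤ c₇ → ∃ U₇ : ℝ, 0 < U₇ ∧
          ∀ μ ∈ klWindowC, ∀ U : ℝ, 0 < U → U ≤ U₇ → ∀ β : ℝ, klBetaMin ≤ β → β ≤ Real.exp (c / U ^ 2) →
            ∀ (K : TrigPolyC4v) (Lstar : ℕ) (Mstar : ℕ → ℕ), TowerP klPredsV17F2 G P Q R β U μ K Lstar Mstar →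
            ∀ Λ : ℝ, 0 ≤ Λ → Λ ≤ klScale klE0 (nScales β + 1) → Λ * (4 : ℝ) ^ (nScales β + 1) ≤ ρ →
            ∃ L₂ : ℕ, ∃ M₂ : ℕ → ℕ → ℕ, ∀ (L b M : ℕ) [NeZero L] [NeZero (b * L)] [NeZero M], L₂ ≤ L → M₂ L b ≤ M →
              (∀ j, j < nScales β → ScaleCovData (klStepCov L M β μ (klFlowFrameU L M β U μ (nScales β + 1)) j) Λ (Real.sqrt (k₁ ^ 2 * ((8 : ℝ) ^ j)⁻¹))
                (a₁ * (4 : ℝ) ^ j / imagTimeWeight β M) s₁) ∧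
              (∀ j, j < nScales β → ScaleCovData (klStepCov (b * L) M β μ (klFlowFrameU (b * L) M β U μ (nScales β + 1)) j) Λ (Real.sqrt (k₁ ^ 2 * ((8 : ℝ) ^ j)⁻¹))
                (a₁ * (4 : ℝ) ^ j / imagTimeWeight β M) s₁) ∧
              (∀ j, j < nScales β → ScaleCovData (klStepCov (b * L) M β μ (klFlowFrameU L M β U μ (nScales β + 1)) j) Λ (Real.sqrt (k₁ ^ 2 * ((8 : ℝ) ^ j)⁻¹))
                (a₁ * (4 : ℝ) ^ j / imagTimeWeight β M) s₁) ∧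
              (∀ j, j < nScales β → ScaleCovSecData (klStepCov (b * L) M β μ (klFlowFrameU L M β U μ (nScales β + 1)) j) Λ e₁) ∧
              (∀ j, j ≤ nScales β → TransferWtData (klTowerTransfer (b * L) M β μ (klFlowFrameU L M β U μ (nScales β + 1)) j)
                (klBlockEquivD L b M j) (klBlockEquivD L b M (j - 1)) Λ w₁))
    (HE1 : ∀ (G : GeoConsts) (P : SplitConsts) (Q : EngConsts) (R : RenConsts), G.WF → P.WF → Q.WF → R.WF2 →
      ∃ C₀ : ℝ, 0 ≤ C₀ ∧
        ∃ c₇ : ℝ, 0 < c₇ ∧ ∀ c : ℝ, 0 < c → c ≤ c₇ → ∃ U₇ : ℝ, 0 < U₇ ∧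
          ∀ μ ∈ klWindowC, ∀ U : ℝ, 0 < U → U ≤ U₇ → ∀ β : ℝ, klBetaMin ≤ β → β ≤ Real.exp (c / U ^ 2) →
            ∀ (K : TrigPolyC4v) (Lstar : ℕ) (Mstar : ℕ → ℕ), TowerP klPredsV17F2 G P Q R β U μ K Lstar Mstar →
            ∃ S₀ : ℕ → ℕ → ℝ, (∀ j m, 0 ≤ S₀ j m) ∧ (∀ j, j ≤ nScales β → ∀ m, 1 ≤ m → S₀ j (2 * m) ≤ C₀ * klWtBudget P Q U (j + 1) (2 * m)) ∧
            ∃ L₂ : ℕ, ∃ M₂ : ℕ → ℕ, ∀ (L M : ℕ) [NeZero L] [NeZero M], L₂ ≤ L → M₂ L ≤ M →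
              (∀ k, k ≤ nScales β → hubbardEffPartitionFnCT L M β U μ 0 (klFlowFrameU L M β U μ (nScales β + 1)) (klScale klE0 (k + 1)) ≠ 0) ∧
              (∀ j, j ≤ nScales β → ∀ (m : ℕ) (q : Fin m) (w : SpaceTimeIdx L M × SectorLeg (sectorCount j)),
                klWtPinnedSumAt L M β μ (klFlowFrameU L M β U μ (nScales β + 1)) j j m (klEffectiveAction L M β U μ (klFlowFrameU L M β U μ (nScales β + 1)) klE0 (j + 1)) q w ≤ S₀ j m))
    (Hmis : ∀ (G : GeoConsts) (P : SplitConsts) (Q : EngConsts) (R : RenConsts), G.WF → P.WF → Q.WF → R.WF2 →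
        ∃ c₇ : ℝ, 0 < c₇ ∧ ∀ c : ℝ, 0 < c → c ≤ c₇ → ∃ U₇ : ℝ, 0 < U₇ ∧
          ∀ μ ∈ klWindowC, ∀ U : ℝ, 0 < U → U ≤ U₇ → ∀ β : ℝ, klBetaMin ≤ β → β ≤ Real.exp (c / U ^ 2) →
            ∀ (K : TrigPolyC4v) (Lstar : ℕ) (Mstar : ℕ → ℕ), TowerP klPredsV17F2 G P Q R β U μ K Lstar Mstar →
            ∃ (sE cR cC δ : ℕ → ℕ → ℝ),
              (∀ j L, 0 ≤ sE j L ∧ 0 ≤ cR j L ∧ 0 ≤ cC j L ∧ 0 ≤ δ j L ∧ cR j L ≤ 1 ∧ cC j L ≤ 1 ∧ δ j L ≤ 1) ∧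
              (∀ j, Tendsto (sE j) atTop (𝓝 0) ∧ Tendsto (cR j) atTop (𝓝 0) ∧ Tendsto (cC j) atTop (𝓝 0) ∧ Tendsto (δ j) atTop (𝓝 0)) ∧
            ∃ L₂ : ℕ, ∃ M₂ : ℕ → ℕ → ℕ, ∀ (L b M : ℕ) [NeZero L] [NeZero (b * L)] [NeZero M], L₂ ≤ L → M₂ L b ≤ M →
              (∀ j, j < nScales β → ∀ x y, ‖(klStepCov (b * L) M β μ (klFlowFrameU (b * L) M β U μ (nScales β + 1)) j - klStepCov (b * L) M β μ (klFlowFrameU L M β U μ (nScales β + 1)) j) x y‖ ≤ sE j L) ∧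
              (∀ j, j < nScales β → ∀ x, ∑ y, ‖(klStepCov (b * L) M β μ (klFlowFrameU (b * L) M β U μ (nScales β + 1)) j - klStepCov (b * L) M β μ (klFlowFrameU L M β U μ (nScales β + 1)) j) x y‖ ≤
                cR j L / imagTimeWeight β M) ∧
              (∀ j, j < nScales β → ∀ y, ∑ x, ‖(klStepCov (b * L) M β μ (klFlowFrameU (b * L) M β U μ (nScales β + 1)) j - klStepCov (b * L) M β μ (klFlowFrameU L M β U μ (nScales β + 1)) j) x y‖ ≤
                cC j L / imagTimeWeight β M) ∧
              (∀ j, j ≤ nScales β → ∀ x, ∑ y, ‖klTowerTransfer (b * L) M β μ (klFlowFrameU (b * L) M β U μ (nScales β + 1)) j x y - klTowerTransfer (b * L) M β μ (klFlowFrameU L M β U μ (nScales β + 1)) j x y‖ ≤ δ j L) ∧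
              (∀ j, j ≤ nScales β → ∀ y, ∑ x, ‖klTowerTransfer (b * L) M β μ (klFlowFrameU (b * L) M β U μ (nScales β + 1)) j x y - klTowerTransfer (b * L) M β μ (klFlowFrameU L M β U μ (nScales β + 1)) j x y‖ ≤ δ j L))
    (Hbase : ∀ (G : GeoConsts) (P : SplitConsts) (Q : EngConsts) (R : RenConsts), G.WF → P.WF → Q.WF → R.WF2 →
        ∃ c₇ : ℝ, 0 < c₇ ∧ ∀ c : ℝ, 0 < c → c ≤ c₇ → ∃ U₇ : ℝ, 0 < U₇ ∧
          ∀ μ ∈ klWindowC, ∀ U : ℝ, 0 < U → U ≤ U₇ → ∀ β : ℝ, klBetaMin ≤ β → β ≤ Real.exp (c / U ^ 2) →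
            ∀ (K : TrigPolyC4v) (Lstar : ℕ) (Mstar : ℕ → ℕ), TowerP klPredsV17F2 G P Q R β U μ K Lstar Mstar →
            ∃ (ΛgT cgW Λg δgb : ℝ) (NG : ℕ → ℝ) (δg : ℕ → ℝ), 0 < ΛgT ∧ 0 ≤ cgW ∧ 0 < Λg ∧ (∀ k, 0 ≤ NG k) ∧ (∀ L, 0 ≤ δg L ∧ δg L ≤ δgb) ∧
              Tendsto δg atTop (𝓝 0) ∧
            ∃ L₂ : ℕ, ∃ M₂ : ℕ → ℕ → ℕ, ∀ (L b M : ℕ) [NeZero L] [NeZero (b * L)] [NeZero M], L₂ ≤ L → M₂ L b ≤ M →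
              (∀ x : SrcLabel (b * L) M 0, ∑ y, ‖klBaseTransfer (b * L) M β μ (klFlowFrameU L M β U μ (nScales β + 1)) x y‖ * (1 + ΛgT * (Torus.tnorm (x.1.1.2 - y.1.1.1.2) : ℝ)) ≤ cgW) ∧
              (∀ y : GridLeg (GridPoint (b * L) (klGridN M)) × Fin 2, ∑ x, ‖klBaseTransfer (b * L) M β μ (klFlowFrameU L M β U μ (nScales β + 1)) x y‖ * (1 + ΛgT * (Torus.tnorm (x.1.1.2 - y.1.1.1.2) : ℝ)) ≤ cgW) ∧
              (∀ (δ' β' β₁ : Fin 2 → Fin b) (xbar : SrcLabel L M 0) (y : GridLeg (GridPoint L (klGridN M)) × Fin 2),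
                ‖klBaseTransfer (b * L) M β μ (klFlowFrameU L M β U μ (nScales β + 1)) ((klBlockEquivD L b M 0).symm (β' + δ', xbar)) ((klGridBlockEquivD L b M).symm (β₁ + δ', y))‖ =
                  ‖klBaseTransfer (b * L) M β μ (klFlowFrameU L M β U μ (nScales β + 1)) ((klBlockEquivD L b M 0).symm (β', xbar)) ((klGridBlockEquivD L b M).symm (β₁, y))‖) ∧
              (∀ x, ∑ y, ‖klBaseTransfer (b * L) M β μ (klFlowFrameU (b * L) M β U μ (nScales β + 1)) x y - klBaseTransfer (b * L) M β μ (klFlowFrameU L M β U μ (nScales β + 1)) x y‖ ≤ δg L) ∧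
              (∀ y, ∑ x, ‖klBaseTransfer (b * L) M β μ (klFlowFrameU (b * L) M β U μ (nScales β + 1)) x y - klBaseTransfer (b * L) M β μ (klFlowFrameU L M β U μ (nScales β + 1)) x y‖ ≤ δg L) ∧
              (∀ (k : ℕ) (p : Fin k) (y : GridLeg (GridPoint L (klGridN M))),
                ∑ Y ∈ univ.filter (fun Y : Fin k → GridLeg (GridPoint L (klGridN M)) => Y p = y),
                  ‖kernel ℂ (klGridAction L M β U μ (klFlowFrameU L M β U μ (nScales β + 1))) k Y‖ *
                    (1 + labelDiam (fun Y₁ Y₂ : GridLeg (GridPoint L (klGridN M)) => Λg * (Torus.tnorm (Y₁.1.1.2 - Y₂.1.1.2) : ℝ)) (univ.image Y)) ≤ imagTimeWeight β M * NG k) ∧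
              (∀ (k : ℕ) (p : Fin k) (y : GridLeg (GridPoint (b * L) (klGridN M))),
                ∑ Y ∈ univ.filter (fun Y : Fin k → GridLeg (GridPoint (b * L) (klGridN M)) => Y p = y),
                  ‖kernel ℂ (klGridAction (b * L) M β U μ (klFlowFrameU (b * L) M β U μ (nScales β + 1))) k Y‖ *
                    (1 + labelDiam (fun Y₁ Y₂ : GridLeg (GridPoint (b * L) (klGridN M)) => Λg * (Torus.tnorm (Y₁.1.1.2 - Y₂.1.1.2) : ℝ)) (univ.image Y)) ≤ imagTimeWeight β M * NG k))
    (Hgrid : ∀ (G : GeoConsts) (P : SplitConsts) (Q : EngConsts) (R : RenConsts), G.WF → P.WF → Q.WF → R.WF2 →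
        ∃ c₇ : ℝ, 0 < c₇ ∧ ∀ c : ℝ, 0 < c → c ≤ c₇ → ∃ U₇ : ℝ, 0 < U₇ ∧
          ∀ μ ∈ klWindowC, ∀ U : ℝ, 0 < U → U ≤ U₇ → ∀ β : ℝ, klBetaMin ≤ β → β ≤ Real.exp (c / U ^ 2) →
            ∀ (K : TrigPolyC4v) (Lstar : ℕ) (Mstar : ℕ → ℕ), TowerP klPredsV17F2 G P Q R β U μ K Lstar Mstar →
            ∃ (κE aC cb κg κg' ρS ρg' ρg₂ ρgf aw al al' mo mo' s s' Θ νW νf νg₂ νD : ℝ) (sgE cc eE tT Te : ℕ → ℝ) (D₀ : ℕ),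
              (0 < κE ∧ 0 < aC ∧ 0 < κg ∧ 0 < κg' ∧ 0 < ρS ∧ 0 < ρg' ∧ 0 < ρg₂ ∧ 0 < ρgf ∧ 0 < aw ∧ 0 < al' + al ∧ 0 ≤ mo ∧ 0 ≤ mo' ∧ 0 ≤ s ∧ 0 ≤ s' ∧
                0 ≤ Θ ∧ 0 ≤ νW ∧ 0 ≤ νf ∧ 0 ≤ νg₂) ∧
              (Real.exp 1 * (aC + cb) * νW / κE ^ 2 < 1 ∧ Real.exp 1 * aw * Θ / κg' ^ 2 < 1 ∧
                Real.exp 1 * (al' + al + (mo' + mo)) * νf / (κg' + κg) ^ 2 < 1 ∧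
                Real.exp 1 * (al' + al + (mo' + mo)) * νg₂ / (κg' + κg + (κg' + κg + (κg' + κg))) ^ 2 < 1) ∧
              (∀ L, 0 ≤ sgE L ∧ 0 ≤ cc L ∧ 2 * cc L ≤ cb ∧ 0 < tT L ∧ 0 ≤ Te L) ∧
              (Tendsto sgE atTop (𝓝 0) ∧ Tendsto cc atTop (𝓝 0) ∧ Tendsto eE atTop (𝓝 0) ∧ Tendsto tT atTop (𝓝 0) ∧ Tendsto Te atTop (𝓝 0)) ∧
            ∃ L₂ : ℕ, ∃ M₂ : ℕ → ℕ → ℕ, ∀ (L b M : ℕ) [NeZero L] [NeZero (b * L)] [NeZero M], L₂ ≤ L → M₂ L b ≤ M →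
              Nonempty (TowerGridDataD L b M β U μ (klFlowFrameU L M β U μ (nScales β + 1)) (klFlowFrameU (b * L) M β U μ (nScales β + 1)) (imagTimeWeight β M) κE aC κg κg' ρS ρg' ρg₂ ρgf aw al al' mo mo' s s' Θ νW νf νg₂ νD
                (sgE L) (cc L) (eE L) (tT L) (Te L) (Nat.sqrt (L / (4 * nScales β + 7))) ((L / (4 * nScales β + 7)) - Nat.sqrt (L / (4 * nScales β + 7))) D₀))
    (hSrc : ∀ (P : SplitConsts) (R : RenConsts), P.WF → R.WF2 →
      ∃ Q' : EngConsts, 0 ≤ Q'.CE ∧ ∃ c₀ : ℝ, 0 < c₀ ∧ ∀ c : ℝ, 0 < c → c ≤ c₀ → ∃ U₀ : ℝ, 0 < U₀ ∧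
        ∀ μ ∈ klWindowC, ∀ U : ℝ, 0 < U → U ≤ U₀ → ∀ β : ℝ, klBetaMin ≤ β → β ≤ Real.exp (c / U ^ 2) →
          ∃ A : ℕ → ℕ → ℝ, ∃ L₁ : ℕ, ∃ M₁ : ℕ → ℕ, ∀ (L M : ℕ) [NeZero L] [NeZero M], L₁ ≤ L → M₁ L ≤ M →
            ∀ j : ℕ, j + 1 ≤ nScales β + 1 →
              SourceProfilesAtLev L M (klSrcBudget P Q' U A (j + 1)) β U μ (klFlowFrameU L M β U μ (nScales β + 1)) j j (j + 1))
    (G : GeoConsts) (P : SplitConsts) (Q : EngConsts) (R : RenConsts) (hG : G.WF) (hP : P.WF) (hQ : Q.WF) (hR2 : R.WF2) :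
    ∃ c₅ : ℝ, 0 < c₅ ∧ ∀ c : ℝ, 0 < c → c ≤ c₅ → ∃ U₀ : ℝ, 0 < U₀ ∧
      ∀ μ ∈ klWindowC, ∀ U : ℝ, 0 < U → U ≤ U₀ → ∀ β : ℝ, klBetaMin ≤ β → β ≤ Real.exp (c / U ^ 2) →
        ∀ K : TrigPolyC4v, klPredsV17F2.frameOK R U (nScales β) μ K →
          ∀ (Lstar : ℕ) (Mstar : ℕ → ℕ), TowerP klPredsV17F2 G P Q R β U μ K Lstar Mstar →
            ∃ t : ℝ, 0 < t ∧ t ≤ 1 ∧ Nonempty (TowerDataTS β U μ t) := by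
  -- the producer text at `(P, R₁)`
  have hR₁ : (⟨1, 1, fun _ => 1⟩ : RenConsts).WF2 := ⟨⟨zero_le_one, zero_le_one, fun _ => zero_le_one⟩, one_pos, one_pos⟩
  obtain ⟨Q', hQ'CE, c₀, hc₀, hS⟩ := hSrc P ⟨1, 1, fun _ => 1⟩ hP hR₁
  have hKl : 0 < P.Klam := lt_of_lt_of_le one_pos hP.1
  have hKl0 : 0 ≤ P.Klam := hKl.le
  -- the body of `hSup` at `(G, P, Q, R, Q')` from the atoms, and the `ε`-doors
  obtain ⟨k₀, B₂, B₃, W, hk₀, hB₂, hB₃, hW, c₆, hc₆, hsup⟩ := hSupRegBody_of_atoms Hcov HE1 Hmis Hbase Hgrid G P Q R Q' hG hP hQ hR2 hQ'CE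
  obtain ⟨c₅, hc₅, U₅, hU₅, hdoors⟩ := exists_doors_towerEps hKl hB₂ hB₃ hW hk₀
  refine ⟨min (min c₅ c₀) c₆, lt_min (lt_min hc₅ hc₀) hc₆, fun c hc0 hcc => ?_⟩
  have hcc₅ : c ≤ c₅ := hcc.trans ((min_le_left _ _).trans (min_le_left _ _))
  have hcc₀ : c ≤ c₀ := hcc.trans ((min_le_left _ _).trans (min_le_right _ _))
  have hcc₆ : c ≤ c₆ := hcc.trans (min_le_right _ _)
  obtain ⟨U₀, hU₀, hS2⟩ := hS c hc0 hcc₀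
  obtain ⟨U₆, hU₆, hsup2⟩ := hsup c hc0 hcc₆
  refine ⟨min (min U₅ U₀) U₆, lt_min (lt_min hU₅ hU₀) hU₆, fun μ hμ U hU0 hUU β hβmin hβmax K hK Lstar Mstar hT => ?_⟩
  have hUU₅ : U ≤ U₅ := hUU.trans ((min_le_left _ _).trans (min_le_left _ _))
  have hUU₀ : U ≤ U₀ := hUU.trans ((min_le_left _ _).trans (min_le_right _ _))
  have hUU₆ : U ≤ U₆ := hUU.trans (min_le_right _ _)
  obtain ⟨A, L₁, M₁, hA⟩ := hS2 μ hμ U hU0 hUU₀ β hβmin hβmax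
  have hUabs : |U| ≤ U₅ := by rw [abs_of_pos hU0]; exact hUU₅
  refine hsup2 μ hμ U hU0 hUU₆ β hβmin hβmax K hK Lstar Mstar hT (fun j hj => hdoors c hc0.le hcc₅ U hU0.ne' hUabs β hβmin hβmax j hj)
    (fun j s => max (A j s) 0) L₁ M₁ (fun j s => le_max_right _ _) ?_
  intro L M _ _ hL hM j hj
  exact (hA L M hL hM j hj).mono fun s m => klSrcBudget_mono_A P Q' U hQ'CE hKl0 (fun j s => le_max_left _ _) (j + 1) s m

end Summit.HubbardSuperconductivity.HubbardSuperconductivity.Theorems.TwoVolumeSource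

end
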